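import Summits.MatrixMultiplication.MatrixMultiplication.Theorems.AsymptoticRankCWSkewQuantumTie
import Summits.MatrixMultiplication.MatrixMultiplication.Theorems.AsymptoticRankCWSkewPencilDichotomy

/-!
# The torus pencil through `T_cw,2` and `ε`, V: the known spectrum is constant along the pencil
(route `MatrixMultiplication/AsymptoticRankCW`; support item `BSkewDominatesCw` =
stmt-MatrixMultiplication-18009, stub `stub_skewDominatesCw` of the line `skew_anchor` of the crux
`BThesis` = stmt-MatrixMultiplication-0588)

`T_ρ (a, a+1, a+2) = 1`, `T_ρ (a, a+2, a+1) = ρ` (inline), `T_1 ≅ T_cw,2`, `T_{-1} = ε`, `T_0 ≅ ⟨3⟩`.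

Part II located item 18009 in the countable exceptional set `E = {ρ : R̃(T_ρ) < sup}` of the pencil.
Here: the KNOWN part of the asymptotic spectrum cannot see `E` at all. For every `ρ ≠ 0` the support
of `T_ρ` in the standard bases is exactly the six permutation cells — a free set carrying the uniform
distribution with uniform marginals — so by the core evaluation of `AsymptoticRankCWSkewQuantumTie`
(CVZ Thm. 4.20 lower bound + Thm. 3.19.5 upper bound) every quantum functional takes the value `3`:

* `quantumFunctionalPoint_pencil_eq_three : ρ ≠ 0 → F^θ(T_ρ) = 3` for all `θ ∈ P([3])`, hence
  `quantumFunctionalPoint_pencil_eq_pencil`: `F^θ(T_ρ) = F^θ(T_ρ')` for all `ρ, ρ' ≠ 0` — the quantum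
  functionals are CONSTANT on the punctured pencil, equal to the flattening bound `3 ≤ R̃(T_ρ)`
  (`quantumFunctionalPoint_pencil_le_asymptoticRank`); no known spectral point distinguishes an
  exceptional member from a generic one, in particular none orders the two anchors of 18009.
* **Quantum universality flattens the pencil** (`asymptoticRank_pencil_eq_three_of_quantumUniversality`,
  `iSup_asymptoticRank_pencil_eq_three_of_quantumUniversality`,
  `pencil_exceptional_eq_empty_of_quantumUniversality`): under the CVZ universality hypothesis (item
  `AQuantumUniversality` of route `AsymptoticSpectrum`, stmt-0582, verbatim as in part `QuantumTie`)
  `R̃(T_ρ) = 3` for every `ρ`, the supremum over the pencil is `3`, and the exceptional set is empty —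
  the second branch of the dichotomy `pencil_arc_dichotomy`.

References: M. Christandl, P. Vrana, J. Zuiddam, J. Amer. Math. Soc. 36 (2023) = arXiv:1709.07851,
Prop. 1.6, Thm. 3.19.5, Cor. 3.31, Thm. 4.20.
-/

set_option linter.dupNamespace false

noncomputable section

namespace Summit.MatrixMultiplication.MatrixMultiplication.Theorems

open scoped BigOperators
open Literature.Computability.AlgebraicComplexity

/-! ## Support of the punctured pencil -/

section Support

/-- `T_ρ ≠ 0` (entry `(0,1,2)` is `1`). [folklore] -/
theorem pencil_ne_zero (ρ : ℂ) :
    (fun a b c : Fin 3 => (if b = a + 1 ∧ c = a + 2 then (1 : ℂ) else 0) +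
      ρ * (if b = a + 2 ∧ c = a + 1 then (1 : ℂ) else 0)) ≠ 0 := by
  intro h
  have := congrFun (congrFun (congrFun h 0) 1) 2
  simp at this

/-- For `ρ ≠ 0` the support of `T_ρ` in the standard bases is exactly the six permutation cells.
[folklore] -/
theorem tensorSupport_pencil {ρ : ℂ} (hρ : ρ ≠ 0) :
    tensorSupport (fun a b c : Fin 3 => (if b = a + 1 ∧ c = a + 2 then (1 : ℂ) else 0) +
      ρ * (if b = a + 2 ∧ c = a + 1 then (1 : ℂ) else 0)) =
      ({p : Fin 3 × Fin 3 × Fin 3 | p.1 ≠ p.2.1 ∧ p.2.1 ≠ p.2.2 ∧ p.1 ≠ p.2.2} :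
        Set (Fin 3 × Fin 3 × Fin 3)) := by
  ext ⟨a, b, c⟩
  simp only [mem_tensorSupport, Set.mem_setOf_eq]
  fin_cases a <;> fin_cases b <;> fin_cases c <;> simp [hρ]

end Support

/-! ## Quantum functionals are constant `3` on the punctured pencil -/

section Quantum

/-- **`F^θ(T_ρ) = 3`** for every `ρ ≠ 0` and every `θ ∈ P([3])` (quantum functional).
[cite: ChristandlVranaZuiddam2023, Thm. 4.20] -/
theorem quantumFunctional_pencil_eq_three {ρ : ℂ} (hρ : ρ ≠ 0) {θ : Fin 3 → ℝ}
    (hθ : θ ∈ stdSimplex ℝ (Fin 3)) :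
    quantumFunctional θ (fun a b c : Fin 3 => (if b = a + 1 ∧ c = a + 2 then (1 : ℂ) else 0) +
      ρ * (if b = a + 2 ∧ c = a + 1 then (1 : ℂ) else 0)) = 3 := by
  refine quantumFunctional_eq_three_of_support_eq_permCells hθ (pencil_ne_zero ρ)
    ((1 : GL (Fin 3) ℂ), (1 : GL (Fin 3) ℂ), (1 : GL (Fin 3) ℂ)) ?_
  simpa using tensorSupport_pencil hρ

/-- **`quantumFunctionalPoint θ (T_ρ) = 3`** for `ρ ≠ 0` (the universal spectral point `F^θ`).
[cite: ChristandlVranaZuiddam2023, Cor. 3.31] -/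
theorem quantumFunctionalPoint_pencil_eq_three {ρ : ℂ} (hρ : ρ ≠ 0) {θ : Fin 3 → ℝ}
    (hθ : θ ∈ stdSimplex ℝ (Fin 3)) :
    quantumFunctionalPoint θ (fun a b c : Fin 3 => (if b = a + 1 ∧ c = a + 2 then (1 : ℂ) else 0) +
      ρ * (if b = a + 2 ∧ c = a + 1 then (1 : ℂ) else 0)) = 3 := by
  rw [quantumFunctionalPoint_apply]
  exact quantumFunctional_pencil_eq_three hρ hθ

/-- **The known spectrum is constant on the punctured pencil**: `F^θ(T_ρ) = F^θ(T_ρ')` for all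
`ρ, ρ' ≠ 0` — no quantum functional distinguishes an exceptional member of the pencil (part II) from a
generic one; in particular none orders the two anchors `ρ = ±1` of item 18009.
[cite: ChristandlVranaZuiddam2023, Cor. 3.31] -/
theorem quantumFunctionalPoint_pencil_eq_pencil {ρ ρ' : ℂ} (hρ : ρ ≠ 0) (hρ' : ρ' ≠ 0)
    {θ : Fin 3 → ℝ} (hθ : θ ∈ stdSimplex ℝ (Fin 3)) :
    quantumFunctionalPoint θ (fun a b c : Fin 3 => (if b = a + 1 ∧ c = a + 2 then (1 : ℂ) else 0) +
        ρ * (if b = a + 2 ∧ c = a + 1 then (1 : ℂ) else 0)) =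
      quantumFunctionalPoint θ (fun a b c : Fin 3 => (if b = a + 1 ∧ c = a + 2 then (1 : ℂ) else 0) +
        ρ' * (if b = a + 2 ∧ c = a + 1 then (1 : ℂ) else 0)) := by
  rw [quantumFunctionalPoint_pencil_eq_three hρ hθ, quantumFunctionalPoint_pencil_eq_three hρ' hθ]

/-- Every quantum functional sits exactly at the flattening bound along the punctured pencil:
`F^θ(T_ρ) = 3 ≤ R̃(T_ρ)`. [cite: ChristandlVranaZuiddam2023, Prop. 1.6] -/
theorem quantumFunctionalPoint_pencil_le_asymptoticRank {ρ : ℂ} (hρ : ρ ≠ 0) {θ : Fin 3 → ℝ}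
    (hθ : θ ∈ stdSimplex ℝ (Fin 3)) :
    quantumFunctionalPoint θ (fun a b c : Fin 3 => (if b = a + 1 ∧ c = a + 2 then (1 : ℂ) else 0) +
        ρ * (if b = a + 2 ∧ c = a + 1 then (1 : ℂ) else 0)) = 3 ∧
      (3 : ℝ) ≤ asymptoticRank (fun a b c : Fin 3 => (if b = a + 1 ∧ c = a + 2 then (1 : ℂ) else 0) +
        ρ * (if b = a + 2 ∧ c = a + 1 then (1 : ℂ) else 0)) :=
  ⟨quantumFunctionalPoint_pencil_eq_three hρ hθ, three_le_asymptoticRank_pencil ρ⟩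

end Quantum

/-! ## Quantum universality flattens the pencil -/

section Universality

/-- **Quantum universality ⇒ `R̃(T_ρ) = 3` for every `ρ`**: for `ρ ≠ 0` the spectral point attaining
`R̃(T_ρ)` (duality) is a quantum functional, equal to `3`; `R̃(T_0) = 3` unconditionally.
[cite: ChristandlVranaZuiddam2023, Prop. 1.6] -/
theorem asymptoticRank_pencil_eq_three_of_quantumUniversality
    (hU : ∀ F : SpectralMap ℂ, IsUniversalSpectralPoint ℂ F → ∃ θ ∈ stdSimplex ℝ (Fin 3),
      ∀ ⦃ι κ μ : Type⦄ [Fintype ι] [Fintype κ] [Fintype μ] (t : ι → κ → μ → ℂ),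
        F t = quantumFunctionalPoint θ t) (ρ : ℂ) :
    asymptoticRank (fun a b c : Fin 3 => (if b = a + 1 ∧ c = a + 2 then (1 : ℂ) else 0) +
      ρ * (if b = a + 2 ∧ c = a + 1 then (1 : ℂ) else 0)) = 3 := by
  by_cases hρ : ρ = 0
  · subst hρ
    exact asymptoticRank_pencil_zero
  obtain ⟨F, hF, hFeq⟩ := (strassen_duality_asymptoticRank_holds ℂ
    (fun a b c : Fin 3 => (if b = a + 1 ∧ c = a + 2 then (1 : ℂ) else 0) +
      ρ * (if b = a + 2 ∧ c = a + 1 then (1 : ℂ) else 0))).2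
  obtain ⟨θ, hθ, hFθ⟩ := hU F hF
  rw [← hFeq, hFθ, quantumFunctionalPoint_pencil_eq_three hρ hθ]

/-- **Quantum universality ⇒ the supremum of `R̃` over the pencil is `3`.**
[cite: ChristandlVranaZuiddam2023, Prop. 1.6] -/
theorem iSup_asymptoticRank_pencil_eq_three_of_quantumUniversality
    (hU : ∀ F : SpectralMap ℂ, IsUniversalSpectralPoint ℂ F → ∃ θ ∈ stdSimplex ℝ (Fin 3),
      ∀ ⦃ι κ μ : Type⦄ [Fintype ι] [Fintype κ] [Fintype μ] (t : ι → κ → μ → ℂ),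
        F t = quantumFunctionalPoint θ t) :
    (⨆ ρ : ℂ, asymptoticRank (fun a b c : Fin 3 => (if b = a + 1 ∧ c = a + 2 then (1 : ℂ) else 0) +
      ρ * (if b = a + 2 ∧ c = a + 1 then (1 : ℂ) else 0))) = 3 := by
  simp_rw [asymptoticRank_pencil_eq_three_of_quantumUniversality hU]
  exact ciSup_const

/-- **Quantum universality ⇒ the exceptional set of the pencil is empty** (every member attains the
supremum `3`): the second branch of `pencil_arc_dichotomy`. [cite: ChristandlVranaZuiddam2023, Prop. 1.6] -/
theorem pencil_exceptional_eq_empty_of_quantumUniversality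
    (hU : ∀ F : SpectralMap ℂ, IsUniversalSpectralPoint ℂ F → ∃ θ ∈ stdSimplex ℝ (Fin 3),
      ∀ ⦃ι κ μ : Type⦄ [Fintype ι] [Fintype κ] [Fintype μ] (t : ι → κ → μ → ℂ),
        F t = quantumFunctionalPoint θ t) :
    {ρ : ℂ | asymptoticRank (fun a b c : Fin 3 =>
        (if b = a + 1 ∧ c = a + 2 then (1 : ℂ) else 0) +
          ρ * (if b = a + 2 ∧ c = a + 1 then (1 : ℂ) else 0)) <
      ⨆ ρ' : ℂ, asymptoticRank (fun a b c : Fin 3 => (if b = a + 1 ∧ c = a + 2 then (1 : ℂ) else 0) +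
        ρ' * (if b = a + 2 ∧ c = a + 1 then (1 : ℂ) else 0))} = ∅ := by
  ext ρ
  simp only [Set.mem_setOf_eq, Set.mem_empty_iff_false, iff_false, not_lt]
  rw [iSup_asymptoticRank_pencil_eq_three_of_quantumUniversality hU,
    asymptoticRank_pencil_eq_three_of_quantumUniversality hU ρ]

/-- **Quantum universality ⇒ every member of the pencil lies in the sublevel set at `3`** — so the
first (finite) branch of the dichotomy `pencil_arc_dichotomy` is then impossible.
[cite: ChristandlVranaZuiddam2023, Prop. 1.6] -/
theorem forall_pencil_le_three_of_quantumUniversality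
    (hU : ∀ F : SpectralMap ℂ, IsUniversalSpectralPoint ℂ F → ∃ θ ∈ stdSimplex ℝ (Fin 3),
      ∀ ⦃ι κ μ : Type⦄ [Fintype ι] [Fintype κ] [Fintype μ] (t : ι → κ → μ → ℂ),
        F t = quantumFunctionalPoint θ t) (ρ : ℂ) :
    asymptoticRank (fun a b c : Fin 3 => (if b = a + 1 ∧ c = a + 2 then (1 : ℂ) else 0) +
      ρ * (if b = a + 2 ∧ c = a + 1 then (1 : ℂ) else 0)) ≤ 3 :=
  (asymptoticRank_pencil_eq_three_of_quantumUniversality hU ρ).le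

end Universality

end Summit.MatrixMultiplication.MatrixMultiplication.Theorems

end
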